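import Mathlib
import HarnessLib
import HarnessLib.Audit
import Summits.HodgeConjecture.Statement
import Literature.AlgebraicGeometry.HodgeTheory.HodgeConjecture
import Literature.AlgebraicGeometry.HodgeTheory.HodgeFiltration
import Literature.AlgebraicGeometry.Motives.Differentials
import Literature.Geometry.Kaehler.HolomorphicChartForms
import Literature.AlgebraicTopology.SingularHomology.CupProduct
import Literature.AlgebraicGeometry.HodgeTheory.ComplexGysin
import HarnessLib.Audit.Status.Attr

/-!
Route: ELineTransport

DORMANT since 2026-08-27T15:06:08Z (reconciler: no traction for 5 d (last activity item-proof-filed at 2026-08-22T13:23:24Z); parked, not closed — `ledger route dormant route-HodgeConjecture-ELineTransport --off` to reactivate) — unstaffed, not closed; items shared with open routes are served there. `ledger route dormant <id> --off` reactivates.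

# Route ELineTransport — E-line transport — an E-structure on the even lattice H²(K3,ℚ) keeps √m
Hodge on twistor lines; hyperholomorphic bundles carry it to S×S

Realises idea card even-b2-e-twistor-real-multiplication (spine). DECLARED SECTOR ROUTE, the D-0027
§2.1-conforming
re-open of route-HodgeConjecture-EvenB2Twistor (retired 2026-08-15T13:48Z `not-a-thesis` because its
Assembly stopped at
`Target`; its items stmt-HodgeConjecture-3238…3245, 3273, 3274 are moot and re-filed here,
restated): it suffices to show
X = `RMSquares` — for every complex projective K3 surface S (smooth projective surface, H¹(S,𝒪) = 0,
nowhere-vanishing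
holomorphic 2-form on a Hodge model: verbatim the body of
`Literature.AlgebraicGeometry.Surfaces.IsK3Surface`) and every
E-STRUCTURE J on H²(S,ℚ) (rational, cup-self-adjoint, J∘J = m with m a non-square, +√m on H^{2,0};
i.e. real multiplication
by E = ℚ(√m) on T(S) extended self-adjointly to NS(S), possible because b₂ = 22 is EVEN) satisfying
EX (End_Hdg(T(S)) is
exactly ℚ + ℚ·J|_T modulo NS) and TC (transfer condition, stated conjugation- and orientation-free:
real (−√m)-eigenvectors of
J are anisotropic ⇔ the (+√m)-eigenspace E₊ ⊂ H²(S,ℝ) has signature (3,8) ⇔ E₊ ∩ NS_ℝ contains a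
positive vector), the Hodge
conjecture holds for S × S: `HodgeConjectureFor 4 (S ⊗ S)`. Equivalently the Künneth class of √m ∈
End_Hdg(T(S)) ⊂ H⁴(S×S,ℚ)
is algebraic — the first open (2,2)-classes of K3 type (Picard 16 known only on two families,
Varesco2025; CM known,
Buskin2019/Huybrechts2019). The frame to the summit is the explicit, NOT-claimed support item
`SectorComplement : RMSquares →
HodgeConjecture`, so that `closes` concludes `_root_.HodgeConjecture`; everything the route attacks
sits in IsogenyInvariance,
CarrierStability, HyperholomorphicTransport, PicardSixteen.
Lean: `IsogenyInvariance → CMAnchor → HighPicardSquares → SectorComplement → _root_.HodgeConjecture`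

## Assembly
Pure logic (theorems `rmSquares_of_cruxes : IsogenyInvariance → CMAnchor → HighPicardSquares →
RMSquares`, `closes` and
`assembly_holds : Assembly` in the planner's Sketch.lean / glue.lean, lean check rc 0, 2026-08-15):
given (S,J) with K3,
E-structure, EX, TC, CMAnchor yields the anchor (S₀,J₀,g,g₄) of Picard number 18, HighPicardSquares
gives HC(S₀ × S₀)
(17 ≤ 18), IsogenyInvariance gives HC(S × S); then the declared sector frame SectorComplement.
PicardSixteen is the ρ = 16
instance of RMSquares (`picardSixteen_of_rmSquares`, proved) and FrameOfSummit its converse frame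
(proved in SketchFrame.lean).

Rationale: WHY THIS LINE. Buskin2019 (arXiv:1510.02852) and Huybrechts2019 (arXiv:1705.04063) made every
rational Hodge ISOMETRY of K3 surfaces algebraic
— Buskin by transporting hyperholomorphic sheaves along twistor paths (engine:
Verbitsky1996Hyperholomorphic Thm 2.5,
Verbitsky1997HyperholomorphicSheaves; Markman2024 and Markman2023GeneralizedKummers §1.2 for the
invariant-class transport on
other hyperkähler types); the totally real part √m ∈ End_Hdg(T(S)) is untouched because on an
ORDINARY twistor line √m stops
being Hodge as soon as H^{2,0} rotates into a Néron–Severi direction (arXiv:1910.13788 §1). Import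
from hyperkähler/gauge
geometry with an explicit dictionary: self-adjoint E-structure J on ALL of H²(S,ℚ) (22 = 2·11;
LatticeEStructure) ↦ E-period
domain D_E = {σ ∈ ℙ(E₊⊗ℂ) : σ² = 0, σσ̄ > 0} of SO(3,8)-type on which J stays Hodge (now a theorem
with a 9-dimensional family of
K3 surfaces of algebraic dimension 0 and End = ℚ(√m): BayerFluckigerVanGeemenSchuett2025
arXiv:2511.19970 Thm 1.3/7.1/Cor 11.4,
BayerFluckigerVanGeemenSchuett2024); irrational Kähler class κ ∈ E₊ ↦ twistor SU(2)_W with W = ⟨Re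
σ, Im σ, κ⟩ ⊂ E₊ on which
J is the scalar √m, so J COMMUTES with SU(2)_W and the class x[Δ] + y·J + z·fibres ∈ H⁴(S×S,ℚ) is
SU(2)-invariant for the
product hyperkähler metric ↦ Verbitsky: a stable bundle with invariant c₁, c₂ is hyperholomorphic
and rides the whole twistor
line with constant Chern classes ↦ chains of E-lines through NS = 0, End = E nodes
(ELineConnectivityR, between endpoint twistor spaces W = P(S) ⊕ ℝκ made Huybrechts-generic — W^⊥ ∩
H²(S,ℚ) = 0 — by a generic Kähler class κ ∈ E₊: polystability is
Kähler-class-independent there and every Hodge class on S_t×S_t is again in ℚ[Δ] + ℚJ + fibres) ↦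
landing on the twistor line
of the projective target itself, GAGA, Künneth bookkeeping under EX. Anchors: Picard-18 K3 surfaces
(rank T = 4 ⇒ CM ⇒
HC(S₀×S₀), HighPicardSquares) exist in EVERY E-isometry class (CMAnchor, by surjectivity of the
period map), so the typed
transport principle IsogenyInvariance + CMAnchor + HighPicardSquares give RMSquares by pure logic
(Sketch.lean, rc 0).
What the line does that prior routes do not: it points twistor transport at a NON-isometric Hodge
endomorphism (a
self-similitude of multiplier m), unconditionally (KugaSatakeSaturation is conditional on KS-HC;
NikulinTwinSimilitude,
retired, needed multiplier 2 and a twin), and it predicts its own range (b₂ even: K3, OG6, OG10; not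
K3^[n], Kum_n).
Negatives index: empty at filing (ledger negatives --problem HodgeConjecture: 0). Since
2026-08-15T20:40Z: 1 — ELineConnectivity (stmt-HodgeConjecture-12555) refuted-misstated (endpoint
twistor spaces not required generic; witness m = 2, W₀ ⟂ e₆,
Theorems/ELineTransportELineConnectivityRefutation.lean); repaired as ELineConnectivityR
(stmt-HodgeConjecture-13981, + W_i^⊥ ∩ ℚ²² = 0); no active item restates the refuted form, and the
deciding theorem `closes` never used it.

RANKED CRUXES. #0 RMSquares (target) — for every projective K3 surface S, every non-square m and
every E-structure J on H²(S,ℚ) (rational, J∘J = m, cup-self-adjoint, +√m on H^{2,0}) with EX (exact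
real multiplication by ℚ(√m)) and TC (real (−√m)-eigenvectors anisotropic), HodgeConjectureFor 4 (S
⊗ S). (why it might fail: Equivalent to HC for these K3 squares: false iff some exact-RM K3 carries
a non-algebraic √m-class (K3 analogue of Weil's exceptional classes); known only for CM (Buskin2019)
and two Picard-16 families (Varesco2025).) [Varesco2025, Varesco2023, Buskin2019, Huybrechts2019,
VanGeemen2008RM, arXiv:2304.02519]
#2 IsogenyInvariance (crux) — TRANSPORT PRINCIPLE (typed parent of the mechanism; card items C1+C3
glued): if (S₁,J₁) [projective K3, E-structure, EX, TC] is E-ISOMETRIC to (S₀,J₀) — g : H²(S₁) ≅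
H²(S₀) rational both ways, g J₁ = J₀ g, cup-compatible through g₄ : H⁴(S₁) ≅ H⁴(S₀) preserving
integral classes (isometry, not similitude) — where S₀ is a projective K3 of Picard number 18 with
J₀ = +√m on H^{2,0}(S₀) and HC(S₀ × S₀) holds, then HC(S₁ × S₁). Proof plan = CarrierStability at S₀
+ HyperholomorphicTransport along an E-line chain from σ(S₀) to g σ(S₁) + landing on S₁'s own
twistor line + GAGA + Künneth bookkeeping under EX. [deps: CMAnchor, HighPicardSquares] [difficulty:
XL] (why it might fail: Needs a μ-stable carrier with c₂ ∈ ℚ[Δ]+ℚ·J₀+fibres, y ≠ 0, at Picard-18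
anchors (NS⊗NS padding dies at the first NS = 0 node) and Verbitsky transport for product metrics; a
Voisin-type vanishing of the J-part of c₂ on generic E-K3×E-K3 kills it.) [Buskin2019,
Verbitsky1996Hyperholomorphic, Verbitsky1997HyperholomorphicSheaves, Markman2023GeneralizedKummers,
BayerFluckigerVanGeemenSchuett2025, arXiv:1910.13788]
#3 PicardSixteen (crux) — FIRST OPEN CASE — RMSquares restricted to Picard number 16 (rank T = 6,
dim_E T = 3: the one-parameter RM families of VanGeemenSchuett2023 and the Elsenhans–Jahnel double
sextics); known only for the two 4-dimensional families with algebraic Kuga–Satake correspondence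
(Varesco2025 Thm 0.2). Designated milestone for the carrier + transport mechanism (explicit anchors
and targets in the same 9-dimensional D_E) and for certified experiments on explicit RM K3 surfaces.
[deps: IsogenyInvariance] [difficulty: open-problem] (why it might fail: Outside the Schlickewei/ILP
families no method applies; a very general member of a 1-parameter RM family (arXiv:2310.05196)
might carry a non-algebraic √m-class — HC could already fail here.) [Varesco2025,
VanGeemenSchuett2023, Schlickewei2010, Varesco2023]
#9 CMAnchor (support) — ANCHORS EXIST IN EVERY E-ISOMETRY CLASS (known mathematics): for (S₁,J₁) a
projective K3 with E-structure and TC there is a projective K3 S₀ of Picard number 18, J₀ with +√m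
on H^{2,0}(S₀), and an E-isometry (g, g₄) as in IsogenyInvariance. Sketch: Λ = H²(S₁,ℤ) with J = J₁;
TC ⇒ E₊ has signature (3,8); take x, y ∈ Λ_ℚ h-orthogonal with ρ-positive squares (density) and T₀
:= Ex ⊕ Ey (signature (2,2), T₀^⊥ of signature (1,17)); σ₀ = isotropic vector of (T₀)_ρ ⊗ ℂ;
NS(σ₀)_ℚ = T₀^⊥ exactly (the minimal ℚ-space containing (T₀)_ρ is J-stable, hence T₀); surjectivity
of the period map in projective form (Literature fact Huybrechts_K3_periodSurjective_projective,
after a marking H²(S₁,ℤ) ≅ Λ_K3) gives S₀; J₀ := transport of J; g₄ from the two orientation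
generators; for a generic choice, after a Weyl change of marking, E₊ ∩ NS(S₀)_ℝ even contains an
ample class (no root is orthogonal to E₊ ∩ NS_ℝ since E₋ has no rational points). [difficulty: L]
[Huybrechts2016K3, BayerFluckigerVanGeemenSchuett2025, VanGeemen2008RM]
#9 HighPicardSquares (support) — KNOWN — HC(S × S) for projective K3 surfaces S of Picard number ≥
17: rank T ≤ 5 forces End_Hdg(T) = ℚ (real multiplication needs dim_E T ≥ 3) or a CM field
(Zarhin1983HodgeGroupsK3); case ℚ: id_T = [Δ] − NS-part − fibres is algebraic; case CM: Buskin2019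
Corollary / Huybrechts2019 Cor 0.4(ii) (Literature fact Buskin2019_hodgeConjectureFor_square_of_CM,
consumed through IsK3Surface = this K3 clause, Iff.rfl); codimensions 0,1,3,4 by Lefschetz (1,1),
hard Lefschetz and points. Supplies HC(S₀×S₀) at the Picard-18 anchors. [difficulty: XL]
[Buskin2019, Huybrechts2019, Zarhin1983HodgeGroupsK3, Huybrechts2016K3, Varesco2025]
#9 LatticeEStructure (support) — E-STRUCTURES EXIST ON THE RATIONAL K3 FORM (provable now): for
non-square m there is Jm ∈ M₂₂(ℚ) with Jm² = m, self-adjoint for D = diag(1,1,1,−1×19) ≅ II_{3,19} ⊗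
ℚ (E₈⊗ℚ ≅ ⟨1⟩⁸), whose (−√m)-eigenspace is negative definite (so E₊ has signature (3,8)). Witness:
over E = ℚ(√m) take H = ⟨√m,√m,√m,−1/2 ×8⟩; tr⟨√m⟩ ≅ U, tr⟨−1/2⟩ = ⟨−1,−m⟩ and ⟨m⟩⁸ ≅ ⟨1⟩⁸ (m is a
sum of four squares, ⟨1,1,1,1⟩ is round), so tr H ≅ D; Jm = multiplication by √m in a rational basis
(BayerFluckigerVanGeemenSchuett2025 Cor 11.4 with r₀ = 3). Grounds D_E and the hypotheses of
ELineConnectivityR. [difficulty: provable-now] [BayerFluckigerVanGeemenSchuett2025,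
BayerFluckigerVanGeemenSchuett2024, VanGeemen2008RM]
#9 ELineConnectivityR (support) — GENERIC E-TWISTOR CONNECTIVITY OF D_E BETWEEN GENERIC ENDPOINTS
(repaired 2026-08-15; its predecessor ELineConnectivity, stmt-HodgeConjecture-12555, was
REFUTED-MISSTATED by Theorems.ELineTransportELineConnectivity_refuted — it demanded generic links
inside ARBITRARY endpoint 3-planes, and W₀ = span(e0,e1,e2) ⟂ rational e₆ (m = 2) admits none, so k
= 0 and W₀ = W₁ were forced; settled negative, dropped from the active items, record kept in the
file): for an E-structure Jm on (ℚ²², D) with negative definite (−√m)-eigenspace, any two positive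
definite 3-planes W₀, W₁ ⊂ E₊ = ker(Jm − √m) that are GENERIC twistor spaces in Huybrechts' sense
(W_i^⊥ ∩ ℚ²² = 0: no nonzero rational vector is D-orthogonal to W_i; Huybrechts2016K3 Ch. 7 §3.1)
are joined by a finite chain of positive 3-planes U₀ = W₀, …, U_k = W₁ in E₊ whose consecutive
members contain Re x, Im x of a common period vector x (Jm x = √m x, x² = 0, x·x̄ > 0) with NS(x) =
x^⊥ ∩ ℚ²² = 0 and End_Hdg(x) = ℚ + ℚ·Jm. Endpoint genericity is necessary (a rational l ⟂ W₀ lies in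
NS of every point of T_{W₀}) and sufficient: the non-generic 2-planes inside a generic 3-space form
a countable subset of Gr(2,W) ≅ ℝP² (one plane l^⊥ ∩ W per rational l ≠ 0, plus the countably many
NS = 0 points whose End_Hdg is a degree-22 field — Schur + [F:ℚ] | 22, F ∋ Jm), and W₀ → P₀ ⊕ ℝw →
⟨w,u⟩ ⊕ ℝw′ → Beauville junction ⟨b, a + εc′, δc″ − εc′⟩ → W₁ (Huybrechts2016K3 Prop 7.3.2) is a
chain of length ≤ 4 with every real parameter chosen off a countable set. The nodes are K3 surfaces
with no curves and End = E, where polystability is Kähler-class independent and Hodge classes on S_t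
× S_t are fibres ⊕ ℚ·id ⊕ ℚ·J; in the K3 application W = P(S) ⊕ ℝκ is generic as soon as the Kähler
class κ ∈ E₊ ∩ NS(S)_ℝ avoids the countably many hyperplanes (l₊)^⊥, l ∈ NS(S)_ℚ ∖ 0. [difficulty:
L] [Huybrechts2016K3, BayerFluckigerVanGeemenSchuett2025, Buskin2019, Zarhin1983HodgeGroupsK3]
#9 FrameOfSummit (support) — FRAME (provable now, PROVED in the planner's SketchFrame.lean via
Literature.AlgebraicGeometry.Motives.IsSmoothProjective.tensor_holds): HodgeConjecture → RMSquares —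
X is an instance family of the summit (S ⊗ S is smooth projective of dimension 4), so X cannot be
refuted without refuting HC. [difficulty: provable-now] [Deligne2000]
#9 SectorComplement (support) — SECTOR FRAME (bookkeeping, NOT claimed; D-0027 §2.1 / D-0019 frame
'X → Statement'): RMSquares → HodgeConjecture. Implied by the Hodge conjecture itself, hence
irrefutable short of ¬HC; filed only so that the deciding theorem `closes` and the Assembly conclude
`_root_.HodgeConjecture` (the predecessor route-HodgeConjecture-EvenB2Twistor was retired
not-a-thesis for stopping at Target). Its honest content — HC away from squares of exact-RM K3
surfaces with TC — is the open complement of the sector: refuters skip, provers have nothing to do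
unless HC is otherwise settled; graders should judge the route on IsogenyInvariance /
CarrierStability / HyperholomorphicTransport / PicardSixteen. [difficulty: open-problem]
[Deligne2000]

TWO-LAYER PLAN. Foreseen glued split (filed as informal cruxes right after open, glue later when the
hyperkähler layer types them):
IsogenyInvariance ⇐ CarrierStability (rank 2, informal: at a Picard-18 anchor, for generic Kähler κ₀
∈ E₊ ∩ Amp(S₀)_ℝ, a
μ_{κ₀⊠κ₀}-stable vector bundle F₀ on S₀×S₀ with c₁ = 0, c₂ = x[Δ] + y·J₀ + z([pt×S₀]+[S₀×pt]), y ≠ 0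
— carriers now exist in
tree as `SmoothComplexVectorBundle` + `IsSlopeStable`, the Chern-class-to-complexBetti bridge does
not) → HyperholomorphicTransport
(rank 4, informal: Verbitsky Thm 2.5 + twistor transform for the product hyperkähler metric on
S_t×S_t, node switching at
NS = 0 / End = E nodes supplied by ELineConnectivityR (generic Kähler classes κ₀, κ₁ make the
endpoint twistor spaces Huybrechts-generic), landing on the target's own twistor line, GAGA, Künneth
under EX) →
IsogenyInvariance. PicardSixteen ⇐ IsogenyInvariance at ρ = 16 (pure logic with CMAnchor +
HighPicardSquares; no split needed).

KILL CRITERIA. (a) A Voisin-type theorem "on a very general K3-type surface M with NS = 0 and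
End_Hdg(H²) = ℚ(√m), every holomorphic bundle /
reflexive sheaf on M×M has c₂ with zero J-component" refutes CarrierStability and
HyperholomorphicTransport at once: close
refuted:CarrierStability (and it is a new Kähler-barrier fact worth cataloguing). (b) A
Bogomolov/Hodge-index-type proof that at
Picard-18 anchors no μ-stable bundle has c₂ ∈ ℚ[Δ] + ℚ·J₀ + fibres with y ≠ 0 kills the carrier;
pivot = padded carriers
c₂ + Σ hᵢ⊗h′ᵢ with hᵢ in a sublattice H′ ⊂ NS common to anchor and target, chains run inside H′^⊥ ∩
E₊ (signature (3, 8 − rk H′)).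
(c) Refutation of IsogenyInvariance, PicardSixteen or RMSquares = a counterexample to HC (closes the
summit negatively).
(d) Mooted if KugaSatakeSaturation + KS-HC, or a generalised Buskin for similitudes, proves HC for
all RM K3 squares first.

NOT DECOMPOSED YET. The glue CarrierStability → HyperholomorphicTransport → IsogenyInvariance stays
informal until the hyperkähler layer reaches
cohomology (in tree now: IsHyperkaehlerTriple, IsSU2InvariantAt,
HermitianHolomorphicBundle.IsHyperholomorphic, IsSlopeStable;
missing: Verbitsky Thm 2.5 / twistor transform as named facts, twistor families of K3 surfaces,
Chern classes of cocycle bundles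
in complexBetti, the complex (non-projective) K3 carrier). The no-effective-carrier lemma N0
(generic RM K3×K3 carries no
analytic 2-cycle with a √m-component: finite ⇒ étale ⇒ graph of an automorphism ⇒ isometry) is
recorded in the card, not
itemised. TC-removal (targets whose E₊ ∩ NS is negative), products S×S′ of E-Hodge-similar K3
surfaces (RMSquares + Buskin2019),
degree-e > 2 totally real fields (e | 22: e = 11 is McMullen's rigid Salem case, no twistor room)
and the OG6/OG10 parity
prediction are out of scope. The sector complement is declared, not attacked.

CHEAPEST FALSIFIER. Run Verbitsky's necessary condition backwards at an explicit anchor: take m = 2,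
the Picard-18 K3 with T ≅ CM by ℚ(ζ₈)
(or m = 3, ℚ(ζ₁₂)), write J₀ = √2 on T ⊕ J_N on NS with E₊ ∩ NS ∋ ample κ₀, and check with
Riemann–Roch + Bogomolov +
Hodge index on S₀×S₀ whether ANY rank r ≤ 4 bundle can have c₁ = 0, c₂ = x[Δ] + yJ₀ + z·fibres, y ≠
0, with
χ(F⊗F*) ≤ … consistent with stability (Δ(F)·(κ₀⊠κ₀)² ≥ 0 gives κ₀²(4x + 2√2·y + 2z)·r ≥ 0 — no
obstruction yet; the
integrality of ch₂ on the lattice ℤ[Δ] + ℤJ₀ + fibres and c₂² = χ-compatible values is the first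
real test). A finite
lattice computation (kit, exact arithmetic); I could not run kit from this planner seat. Second: ask
whether the E-line through
that anchor meets the projective RM locus of arXiv:2511.19970 again (it must, densely — a sanity
check of D_E, pen and paper).

NUMBERS. b₂(K3) = 22 = 2·11 (E-structures exist; K3^[n]: 23, Kum_n: 7 — odd, none; OG6: 8, OG10: 24
— even). E₊ signature (3,8),
E₋ (0,11); dim D_E = 9 (BayerFluckigerVanGeemenSchuett2025 Thm 1.3). Real multiplication by a
degree-e field on T needs
dim_E T ≥ 3, so for e = 2: rank T ∈ {6,…,20} even, ρ = 22 − rank T ∈ {2,…,16} even; anchors ρ = 18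
(rank T = 4, CM);
ρ = 20 admits no E-structure. Known: CM squares (Buskin2019, Huybrechts2019 Cor 0.4(ii)); ρ = 16 on
two 4-dimensional
families (Varesco2025 Thm 0.2); Hodge similarities of rational multiplier (Varesco2023 Thm 5.3).
Items at open: 11 typed
(target, assembly, 2 cruxes, 7 supports incl. the two frames) + 2 informal cruxes (CarrierStability
r2, HyperholomorphicTransport r4) = 13 ≤ 15. After the 2026-08-15 repair (rev 2–3):
ELineConnectivity dropped (refuted record kept as history), ELineConnectivityR added — still 13 ≤
15.

DEFINITION REQUESTS. None blocking: every typed statement is over existing declarations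
(complexBetti, IsRationalClass, IsIntegralClass,
IsOfHodgeType, algebraicClasses, HodgeConjectureFor, HodgeModel, MForm, IsHolomorphicInCharts,
structureSheafCohomology,
cupProduct, Matrix). Wanted for typing the informal cruxes (requests exist from the predecessor
route; re-linked, not re-filed):
Verbitsky1996Hyperholomorphic Thm 2.5 and the twistor transform as named facts over
`HasHyperholomorphicConnection`; twistor
family of a hyperkähler K3 / complex K3 carrier; Chern classes of `SmoothComplexVectorBundle` in
`complexBetti` of a Hodge model.
Cone hygiene: the route deliberately does NOT import Literature.AlgebraicGeometry.Surfaces.K3Surface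
/ K3PeriodSurjectivity /
K3ComplexMultiplication (they carry the unproved named facts Buskin2019_hodgeIsometry_algebraic,
Huybrechts_K3_periodSurjective_projective, Buskin2019_hodgeConjectureFor_square_of_CM); the K3
clause is the verbatim body of
IsK3Surface (Iff.rfl) so Theorems files may use those facts as hypotheses; import cone of this file
= Statement cone + 4 clean
modules (planner check: 38 modules, 0 unproved named facts).

Novelty: Searches (2026-08-15, this seat): `lit search --hybrid "real multiplication K3 surface Hodge
conjecture twistor hyperholomorphic bundle"` (15 book hits, vector leg only: Huybrechts–Lehn, Voisin
I, Laza–Schütt–Yui, Carlson–Müller-Stach–Peters — no RM/twistor treatment); `lit papers --grep K3`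
(1 held: Novario 2025 doi:10.1215/21562261-2024-0040, integral (2,2)-classes on S^[2] of a general
projective K3 — adjacent, b₂ = 23 odd, no RM); remote legs `--source zbmath|arxiv` 0 hits for "K3
real multiplication twistor", openalex/s2 rate-limited (429), local searchd rc 75 — to be re-run by
the refuter; plus the searches recorded on the card (lit search "Hodge similarities algebraic
classes Kuga-Satake K3 real multiplication", "Markman secant sheaves Weil", lit frontier
HodgeConjecture --since 2023) and the g2 novelty audit of the card (17:42Z: zbMATH leg on the
hyperholomorphic side empty; record MSYZ 2408.14775, HMSYZ 2502.09774, BFvGS 2511.19970 +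
2401.04072, van Geemen–Schütt 2310.05196, Elsenhans–Jahnel MMJ 73, Varesco 2304.02519, Huybrechts
1910.13788 reread).
Nearest prior art found: Buskin2019 / Huybrechts2019 (rational Hodge ISOMETRIES algebraic; CM ⇒
HC(S×S)); Markman2023GeneralizedKummers §1.2 and Markman2024 (invariant-class twistor transport as
c₂ of a maximally twisted / hyperholomorphic sheaf — the device); BayerFluckigerVanGeemenSchuett2025
(E-forms with K3 transfer and the 9-dimensional non-projective RM family = the E-period domain, no
twistor or Hodge-conjecture co  [refs: 10.1215/21562261-2024-0040, 1910.13788, doi:10.1215/21562261-2024-0040, Buskin2019, Huybrechts2019, Markman2024, BayerFluckigerVanGeemenSchuett2025, Varesco2023, Varesco2025]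

Barriers (technique_class: twistor-transport, hyperholomorphic-sheaves): - technique_class: twistor-transport, hyperholomorphic-sheaves
- Literature.Barriers.HodgeConjecture.Zucker1977_kaehlerTorus_noAnalyticCycles: non-projective K3
surfaces are used only as a ROAD; the conclusion is drawn on the projective endpoint S×S by
GAGA/Chow (c₂ of an algebraic bundle is algebraic). The barrier bites exactly on carriers: on a
generic RM K3×K3 no analytic 2-cycle carries the √m-class (card lemma N0: finite ⇒ étale ⇒ graph of
an automorphism ⇒ isometry), which is WHY bundles of rank ≥ 2 are transported, as in Buskin's proof.
- Literature.Barriers.HodgeConjecture.Voisin2002_weilTorus_hodgeClassWithoutSubvarieties: the model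
refutation. Voisin's vanishing needs NS = 0, no positive-dimensional proper analytic subsets and
Hdg⁴ ⟂ [ω]^{n−2}; on S_t×S_t the last two fail (fibres, diagonal; [Δ]·ω² = 4κ² > 0) and c₂(I_Δ) =
[Δ] ≠ 0, so the theorem does not apply; a Voisin-TYPE statement for the J-component is kill
criterion (a). At the projective endpoint Chern classes of holomorphic bundles ARE algebraic
(Deligne2000 §2(ii)).
- Literature.Barriers.HodgeConjecture.AtiyahHirzebruch1962_torsionClass_notAlgebraic: everything is
⊗ℚ (x, y, z rational, conclusions rational); no integral claim.
- Literature.Barriers.HodgeConjecture.Kollar1992_nonTorsionClass_notAlgebraic: same — rational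
coefficients only, no claim that y = 1 is reached.
- Literature.Barriers.HodgeConjecture.Clemens1983_griffithsGroup_infiniteRank: no Abel–Jacobi /
Griffiths-group finiteness is used.
- Lite

History (route lifecycle, newest last):
- 2026-08-15T20:40:36Z · BROKEN — ELineConnectivity (stmt-HodgeConjecture-12555, support) refuted by Summit.HodgeConjecture.HodgeConjecture.Theorems.ELineTransportELineConnectivity_refuted @ d05450359ac3 (refuter-refute-pool-g44-53)
- 2026-08-15T20:51:39Z · rev 3: dropped ELineConnectivity — drop refuted ELineConnectivity (stmt-HodgeConjecture-12555): not load-bearing — the deciding theorem closes (IsogenyInvariance → CMAnchor → HighPicardSquares → (planner-rrefute-HodgeConjecture-ELineTransport-debc45a1-0)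
- 2026-08-15T20:51:39Z · REPAIRED (drop ELineConnectivity) — back to open: drop refuted ELineConnectivity (stmt-HodgeConjecture-12555): not load-bearing — the deciding theorem closes (IsogenyInvariance → CMAnchor → HighPicardSquares → (planner-rrefute-HodgeConjecture-ELineTransport-debc45a1-0)
- 2026-08-15T20:58:08Z · rev 5: dropped stmt-HodgeConjecture-13999, stmt-HodgeConjecture-14000 — rfix seat: withdraw my two repair items filed at 20:56Z (stmt-13999 ELineConnectivityR — decl name collides with stmt-13981 already installed by planner-rrefute (planner-rfix-HodgeConjecture-ELineTransport-5fd093a2-0)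
- 2026-08-27T15:06:08Z · DORMANT — reconciler: no traction for 5 d (last activity item-proof-filed at 2026-08-22T13:23:24Z); parked, not closed — `ledger route dormant route-HodgeConjecture-ELine (operator:999:2411438)

sub-problem: HodgeConjecture · status: dormant · opened planner-plancard-HodgeConjecture-HodgeConject-504ab3aa-g2-0 2026-08-15T18:55:26Z · rev 8 · ledger route-HodgeConjecture-ELineTransport
GENERATED by the gate from the ledger (D-0016/17). Provers cite these decls: `theorem foo : Summit.HodgeConjecture.HodgeConjecture.Theses.ELineTransport.<Decl> := …` in Summits/HodgeConjecture/HodgeConjecture/Theorems/<Name>.lean.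
-/

namespace Summit.HodgeConjecture.HodgeConjecture.Theses.ELineTransport

open scoped BigOperators Topology Manifold Classical MeasureTheory ProbabilityTheory Matrix InnerProductSpace ComplexConjugate ContinuousMap
open Filter Set Function TopologicalSpace MeasureTheory

attribute [summit_statement] _root_.HodgeConjecture

/-! Retired items kept as plain definitions (history; not obligations of this route): landed proofs / closed glue still name them. -/

/-- retired stmt-HodgeConjecture-12555 (dropped, gen None) — refuted by Summit.HodgeConjecture.HodgeConjecture.Theorems.ELineTransportELineConnectivity_refuted @ 9a5ff31089d1. -/
def ELineConnectivity : Prop :=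
  ∀ m : ℕ, ¬ IsSquare m → ∀ Jm : Matrix (Fin 22) (Fin 22) ℚ, Jm * Jm = (m : ℚ) • (1 : Matrix (Fin 22) (Fin 22) ℚ) → Jm.transpose * Matrix.diagonal (fun i : Fin 22 => if i.val < 3 then (1 : ℚ) else -1) = Matrix.diagonal (fun i : Fin 22 => if i.val < 3 then (1 : ℚ) else -1) * Jm → (∀ v : Fin 22 → ℝ, v ≠ 0 → (Jm.map (fun x : ℚ => (x : ℝ))).mulVec v = (-(Real.sqrt m)) • v → dotProduct v ((Matrix.diagonal (fun i : Fin 22 => if i.val < 3 then (1 : ℝ) else -1)).mulVec v) < 0) → let q : (Fin 22 → ℝ) → (Fin 22 → ℝ) → ℝ := fun v w => dotProduct v ((Matrix.diagonal (fun i : Fin 22 => if i.val < 3 then (1 : ℝ) else -1)).mulVec w); let qc : (Fin 22 → ℂ) → (Fin 22 → ℂ) → ℂ := fun v w => dotProduct v ((Matrix.diagonal (fun i : Fin 22 => if i.val < 3 then (1 : ℂ) else -1)).mulVec w); let Ep : Submodule ℝ (Fin 22 → ℝ) := LinearMap.ker (Matrix.toLin' (Jm.map (fun x : ℚ => (x :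 ℝ))) - (Real.sqrt m) • LinearMap.id); ∀ (W₀ W₁ : Submodule ℝ (Fin 22 → ℝ)), (W₀ ≤ Ep ∧ Module.finrank ℝ W₀ = 3 ∧ ∀ u ∈ W₀, u ≠ 0 → 0 < q u u) → (W₁ ≤ Ep ∧ Module.finrank ℝ W₁ = 3 ∧ ∀ u ∈ W₁, u ≠ 0 → 0 < q u u) → ∃ (k : ℕ) (U : Fin (k + 1) → Submodule ℝ (Fin 22 → ℝ)), U 0 = W₀ ∧ U (Fin.last k) = W₁ ∧ (∀ i, U i ≤ Ep ∧ Module.finrank ℝ (U i) = 3 ∧ ∀ u ∈ U i, u ≠ 0 → 0 < q u u) ∧ ∀ i : Fin k, ∃ x : Fin 22 → ℂ, (Jm.map (fun t : ℚ => (t : ℂ))).mulVec x = (Real.sqrt m : ℂ) • x ∧ qc x x = 0 ∧ 0 < (qc (star x) x).re ∧ (fun j => (x j).re) ∈ U i.castSucc ⊓ U i.succ ∧ (fun j => (x j).im) ∈ U i.castSucc ⊓ U i.succ ∧ (∀ l : Fin 22 → ℚ, qc (fun j => (l j : ℂ)) x = 0 → l = 0) ∧ ∀ A : Matrix (Fin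 22) (Fin 22) ℚ, (∃ c : ℂ, (A.map (fun t : ℚ => (t : ℂ))).mulVec x = c • x) → (∀ v : Fin 22 → ℂ, qc v x = 0 → qc v (star x) = 0 → qc ((A.map (fun t : ℚ => (t : ℂ))).mulVec v) x = 0 ∧ qc ((A.map (fun t : ℚ => (t : ℂ))).mulVec v) (star x) = 0) → ∃ a b : ℚ, A = a • (1 : Matrix (Fin 22) (Fin 22) ℚ) + b • Jm

/-- item stmt-HodgeConjecture-12549 · target · rank 0 · open · by planner
why it might fail: Sector form of HC: false iff some exact-RM K3 square carries a non-algebraic √m-class (K3 analogue of Weil's exceptional classes). Known only on two Picard-16 families (Varesco2025 Thm 0.2) and for rational-multiplier similarities (Varesco2023); nothing covers a very general RM family.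
sources: Varesco2025, Varesco2023, VanGeemenSchuett2023, VanGeemen2008RM, Buskin2019, arXiv:2304.02519
[target] for every projective K3 surface S, every non-square m and every E-structure J on H²(S,ℚ)
(rational, J∘J = m, cup-self-adjoint, +√m on H^{2,0}) with EX (exact real multiplication by ℚ(√m))
and TC (real (−√m)-eigenvectors anisotropic), HodgeConjectureFor 4 (S ⊗ S). -/
@[route_item "route-HodgeConjecture-ELineTransport"]
def RMSquares : Prop :=
  open Literature.AlgebraicGeometry.Motives Literature.AlgebraicGeometry.HodgeTheory Literature.AlgebraicTopology.SingularHomology in ∀ (S : SchemeOver ℂ), (IsSmoothProjective 2 S ∧ Subsingleton (structureSheafCohomology S.left 1) ∧ ∃ (A : HodgeModel 2 S) (η : Literature.Geometry.Kaehler.MForm 𝓘(ℝ, A.model) A.carrier ℂ 2), Literature.Geometry.Kaehler.IsHolomorphicInCharts η ∧ ∀ x, η x ≠ 0) → ∀ m : ℕ, ¬ IsSquare m → ∀ J : complexBetti S 2 →ₗ[ℂ] complexBetti S 2, ((∀ c, IsRationalClass c → IsRationalClass (J c)) ∧ (∀ c, J (J c) = (m : ℂ) • c) ∧ (∀ a b,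 cupProduct rfl (J a) b = cupProduct rfl a (J b)) ∧ (∀ c, IsOfHodgeType 2 S 2 2 0 c → J c = (Real.sqrt m : ℂ) • c)) → (∀ ψ : complexBetti S 2 →ₗ[ℂ] complexBetti S 2, (∀ c, IsRationalClass c → IsRationalClass (ψ c)) → (∀ p q c, IsOfHodgeType 2 S 2 p q c → IsOfHodgeType 2 S 2 p q (ψ c)) → ∃ a b : ℚ, ∀ v, (∀ w ∈ algebraicClasses S 1, cupProduct rfl v w = 0) → ψ v - ((a : ℂ) • v + (b : ℂ) • J v) ∈ algebraicClasses S 1) → (∀ v ∈ Submodule.span ℝ {c : complexBetti S 2 | IsRationalClass c}, J v = -((Real.sqrt m : ℂ) • v) → cupProduct rfl v v = 0 → v = 0) → HodgeConjectureFor 4 (CategoryTheory.MonoidalCategoryStruct.tensorObj S S)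

/-- item stmt-HodgeConjecture-12550 · crux · rank 2 · open · by planner
why it might fail: Implied by HC, so the PLAN is what fails: slicing a transported carrier at an NS=0 node S′ gives a hypercomplex map S′→M_v(S′); y≠0 needs a trianalytic S′-surface in hyperholomorphic moduli over a node that is Mumford–Tate generic for E-lines — Verbitsky (alg-geom/9705004) forbids this in S′^[n].
sources: Buskin2019, Verbitsky1996Hyperholomorphic, arXiv:alg-geom/9705004, arXiv:math/0205210, Markman2024, Voisin2002KaehlerCounterexample
[crux] TRANSPORT PRINCIPLE (typed parent of the mechanism; card items C1+C3 glued): if (S₁,J₁)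
[projective K3, E-structure, EX, TC] is E-ISOMETRIC to (S₀,J₀) — g : H²(S₁) ≅ H²(S₀) rational both
ways, g J₁ = J₀ g, cup-compatible through g₄ : H⁴(S₁) ≅ H⁴(S₀) preserving integral classes
(isometry, not similitude) — where S₀ is a projective K3 of Picard number 18 with J₀ = +√m on
H^{2,0}(S₀) and HC(S₀ × S₀) holds, then HC(S₁ × S₁). Proof plan = CarrierStability at S₀ +
HyperholomorphicTransport along an E-line chain from σ(S₀) to g σ(S₁) + landing on S₁'s own twistor
line + GAGA + Künneth bookkeeping under EX. [deps: CMAnchor, HighPicardSquares] [difficulty: XL] -/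
@[route_item "route-HodgeConjecture-ELineTransport", crux]
def IsogenyInvariance : Prop :=
  open Literature.AlgebraicGeometry.Motives Literature.AlgebraicGeometry.HodgeTheory Literature.AlgebraicTopology.SingularHomology in ∀ (S₀ S₁ : SchemeOver ℂ), (IsSmoothProjective 2 S₀ ∧ Subsingleton (structureSheafCohomology S₀.left 1) ∧ ∃ (A : HodgeModel 2 S₀) (η : Literature.Geometry.Kaehler.MForm 𝓘(ℝ, A.model) A.carrier ℂ 2), Literature.Geometry.Kaehler.IsHolomorphicInCharts η ∧ ∀ x, η x ≠ 0) → (IsSmoothProjective 2 S₁ ∧ Subsingleton (structureSheafCohomology S₁.left 1) ∧ ∃ (A : HodgeModel 2 S₁) (η : Literature.Geometry.Kaehler.MForm 𝓘(ℝ, A.model) A.carrier ℂ 2), Literature.Geometry.Kaehler.IsHolomorphicInCharts η ∧ ∀ x, η x ≠ 0) → ∀ m : ℕ, ¬ IsSquare m → ∀ (J₀ : complexBetti S₀ 2 →ₗ[ℂ] complexBetti S₀ 2) (J₁ : complexBetti S₁ 2 →ₗ[ℂ] complexBetti S₁ 2), (∀ c, IsOfHodgeType 2 S₀ 2 2 0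 c → J₀ c = (Real.sqrt m : ℂ) • c) → ((∀ c, IsRationalClass c → IsRationalClass (J₁ c)) ∧ (∀ c, J₁ (J₁ c) = (m : ℂ) • c) ∧ (∀ a b, cupProduct rfl (J₁ a) b = cupProduct rfl a (J₁ b)) ∧ (∀ c, IsOfHodgeType 2 S₁ 2 2 0 c → J₁ c = (Real.sqrt m : ℂ) • c)) → Module.finrank ℂ (algebraicClasses S₀ 1) = 18 → (∃ g : complexBetti S₁ 2 ≃ₗ[ℂ] complexBetti S₀ 2, ∃ g₄ : complexBetti S₁ 4 ≃ₗ[ℂ] complexBetti S₀ 4, (∀ c, IsRationalClass c ↔ IsRationalClass (g c)) ∧ (∀ c, g (J₁ c) = J₀ (g c)) ∧ (∀ a b, g₄ (cupProduct rfl a b) = cupProduct rfl (g a) (g b)) ∧ (∀ c, IsIntegralClass c ↔ IsIntegralClass (g₄ c))) → HodgeConjectureFor 4 (CategoryTheory.MonoidalCategoryStruct.tensorObj S₀ S₀) → (∀ ψ : complexBetti S₁ 2 →ₗ[ℂ] complexBetti S₁ 2, (∀ c, IsRationalClass c → IsRationalClass (ψ c)) → (∀ p q c, IsOfHodgeType 2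 S₁ 2 p q c → IsOfHodgeType 2 S₁ 2 p q (ψ c)) → ∃ a b : ℚ, ∀ v, (∀ w ∈ algebraicClasses S₁ 1, cupProduct rfl v w = 0) → ψ v - ((a : ℂ) • v + (b : ℂ) • J₁ v) ∈ algebraicClasses S₁ 1) → (∀ v ∈ Submodule.span ℝ {c : complexBetti S₁ 2 | IsRationalClass c}, J₁ v = -((Real.sqrt m : ℂ) • v) → cupProduct rfl v v = 0 → v = 0) → HodgeConjectureFor 4 (CategoryTheory.MonoidalCategoryStruct.tensorObj S₁ S₁)

-- item stmt-HodgeConjecture-12672 · crux · rank 2 · open · by planner — informal only, no Lean statement yet: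
--   [crux] CARRIER STABILITY AT CM ANCHORS (card item C1; informal until Chern classes of cocycle
--   bundles reach complexBetti — SmoothComplexVectorBundle, IsSlopeStable, HermitianHolomorphicBundle
--   are in tree, the Chern-class-to-Betti bridge and the Kuenneth classes [Delta], [J] in H^4(S x S) are
--   not). For every projective K3 surface S0 of Picard number 18 with an E-structure J0 (rational,
--   cup-self-adjoint, J0 o J0 = m, +sqrt(m) on H^{2,0}; HC(S0 x S0) is known, so the Kuenneth class of
--   J0 is a Q-combination of classes of algebraic surfaces Z_i in S0 x S0) whose (+sqrt m)-eigenspace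
--   E_+ meets the a

-- item stmt-HodgeConjecture-12766 · crux · rank 4 · open · by planner — informal only, no Lean statement yet:
--   [crux] HYPERHOLOMORPHIC TRANSPORT ALONG E-TWISTOR CHAINS (card items C3/C4 glued; informal until
--   Verbitsky's theorems and twistor families are named facts over the tree's IsHyperkaehlerTriple /
--   HasHyperholomorphicConnection / IsSlopeStable, and until a complex (non-projective) K3 carrier
--   exists). Let (Lambda, q, J) = (H^2(S1,Z), cup, J1) with E_+ of signature (3,8) (TC), D_E = {sigma in
--   P(E_+ (x) C) : sigma^2 = 0, sigma.conj(sigma) > 0} the E-period domain, and let (S0, J0, g, g4) be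
--   an anchor (CMAnchor) with a carrier F0 (CarrierStability) for a Kaehler class kappa0 in E_+. CLAIM
--   (=> IsogenyI

/-- item stmt-HodgeConjecture-19049 · aside · rank 2 · open · by planner
why it might fail: Implied by HC (irrefutable short of ¬HC); the MECHANISM dies if Picard-18 anchors carry no μ-stable bundle with c₂ ∋ y·J₀, y≠0, or if E-nodes admit no trianalytic S′-surface in M_v(S′) (Verbitsky alg-geom/9705004 Thm 1.1 forbids them in S′^[n]) — transport then keeps only x[Δ]+fibres.
sources: Buskin2019, Verbitsky1996Hyperholomorphic, arXiv:alg-geom/9705004, Markman2024, BayerFluckigerVanGeemenSchuett2025, arXiv:1910.13788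
[crux — THE TRANSPORT PROPER, piece X₃; the mechanism's whole research content, typed at the level
of ONE explicit class] ALGEBRAICITY OF THE E-CLASS TRANSPORTS ALONG E-ISOMETRIES FROM A PICARD-18
ANCHOR: for μ with Poincaré duality, projective K3 surfaces S₀, S₁, non-square m, E-structures J₀ on
H²(S₀), J₁ on H²(S₁) (rational, J² = m, cup-self-adjoint, +√m on H^{2,0}), Picard number of S₀ equal
to 18, an E-ISOMETRY (g : H²(S₁) ≅ H²(S₀) rational both ways with g J₁ = J₀ g, cup-compatible
through g₄ : H⁴(S₁) ≅ H⁴(S₀) preserving integral classes) and TC on S₁ (real (−√m)-eigenvectors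
anisotropic ⇔ E₊ has signature (3,8)): if J₀ = [γ₀]_* for an algebraic γ₀ on S₀ × S₀ then J₁ =
[γ₁]_* for an algebraic γ₁ on S₁ × S₁. EX is deliberately NOT assumed (the mechanism never uses it;
it enters only X₁) and the E-structure clauses of J₀ are supplied by the assembly (transport through
(g,g₄)). Mechanism = the informal cruxes CarrierStability (stmt-HodgeConjecture-12672: a μ-stable
carrier F₀ on S₀×S₀ with c₂ = x[Δ] + y·J₀ + z·fibres (+ NS-padding), y ≠ 0) and
HyperholomorphicTransport (stmt-HodgeConjecture-12766: Verbitsky's hyperholomorphic transport along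
a chain of generic E-twistor lines in -/
@[route_item "route-HodgeConjecture-ELineTransport"]
def EClassTransport : Prop :=
  open Literature.AlgebraicGeometry.Motives Literature.AlgebraicGeometry.HodgeTheory Literature.AlgebraicTopology.SingularHomology in ∀ (μ : OrientationFamily), μ.HasPoincareDuality → ∀ (S₀ S₁ : SchemeOver ℂ) (hS₀ : (IsSmoothProjective 2 S₀ ∧ Subsingleton (structureSheafCohomology S₀.left 1) ∧ ∃ (A : HodgeModel 2 S₀) (η : Literature.Geometry.Kaehler.MForm 𝓘(ℝ, A.model) A.carrier ℂ 2), Literature.Geometry.Kaehler.IsHolomorphicInCharts η ∧ ∀ x, η x ≠ 0)) (hS₁ : (IsSmoothProjective 2 S₁ ∧ Subsingleton (structureSheafCohomology S₁.left 1) ∧ ∃ (A : HodgeModel 2 S₁) (η : Literature.Geometry.Kaehler.MForm 𝓘(ℝ, A.model) A.carrier ℂ 2), Literature.Geometry.Kaehler.IsHolomorphicInCharts η ∧ ∀ x, η x ≠ 0)), ∀ m : ℕ, ¬ IsSquare m → ∀ (J₀ : complexBetti S₀ 2 →ₗ[ℂ] complexBetti S₀ 2) (J₁ : complexBetti S₁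 2 →ₗ[ℂ] complexBetti S₁ 2), ((∀ c, IsRationalClass c → IsRationalClass (J₀ c)) ∧ (∀ c, J₀ (J₀ c) = (m : ℂ) • c) ∧ (∀ a b, cupProduct rfl (J₀ a) b = cupProduct rfl a (J₀ b)) ∧ (∀ c, IsOfHodgeType 2 S₀ 2 2 0 c → J₀ c = (Real.sqrt m : ℂ) • c)) → ((∀ c, IsRationalClass c → IsRationalClass (J₁ c)) ∧ (∀ c, J₁ (J₁ c) = (m : ℂ) • c) ∧ (∀ a b, cupProduct rfl (J₁ a) b = cupProduct rfl a (J₁ b)) ∧ (∀ c, IsOfHodgeType 2 S₁ 2 2 0 c → J₁ c = (Real.sqrt m : ℂ) • c)) → Module.finrank ℂ (algebraicClasses S₀ 1) = 18 → (∃ g : complexBetti S₁ 2 ≃ₗ[ℂ] complexBetti S₀ 2, ∃ g₄ : complexBetti S₁ 4 ≃ₗ[ℂ] complexBetti S₀ 4, (∀ c, IsRationalClass c ↔ IsRationalClass (g c)) ∧ (∀ c, g (J₁ c) = J₀ (g c)) ∧ (∀ a b, g₄ (cupProduct rfl a b) = cupProduct rfl (g a) (g b)) ∧ (∀ c, IsIntegralClass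 c ↔ IsIntegralClass (g₄ c))) → (∀ v ∈ Submodule.span ℝ {c : complexBetti S₁ 2 | IsRationalClass c}, J₁ v = -((Real.sqrt m : ℂ) • v) → cupProduct rfl v v = 0 → v = 0) → (∃ γ ∈ algebraicClasses (CategoryTheory.MonoidalCategoryStruct.tensorObj S₀ S₀) 2, ∀ x : complexBetti S₀ 2, J₀ x = complexGysin μ (IsSmoothProjective.tensor_holds hS₀.1 hS₀.1) hS₀.1 (CategoryTheory.SemiCartesianMonoidalCategory.fst S₀ S₀) (rfl : 2 + 2 * 2 + 2 * 2 = 2 + 2 * (2 + 2)) (cupProduct (rfl : 2 + 2 * 2 = 2 + 2 * 2) (complexBetti.map (CategoryTheory.SemiCartesianMonoidalCategory.snd S₀ S₀) 2 x) γ)) → (∃ γ ∈ algebraicClasses (CategoryTheory.MonoidalCategoryStruct.tensorObj S₁ S₁) 2, ∀ x : complexBetti S₁ 2, J₁ x = complexGysin μ (IsSmoothProjective.tensor_holds hS₁.1 hS₁.1) hS₁.1 (CategoryTheory.SemiCartesianMonoidalCategory.fst S₁ S₁) (rfl : 2 + 2 * 2 + 2 * 2 = 2 + 2 * (2 + 2))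 (cupProduct (rfl : 2 + 2 * 2 = 2 + 2 * 2) (complexBetti.map (CategoryTheory.SemiCartesianMonoidalCategory.snd S₁ S₁) 2 x) γ))

/-- item stmt-HodgeConjecture-12551 · aside · rank 3 · open · by planner
why it might fail: First open case (rank T = 6): outside the two 4-dim families with algebraic Kuga–Satake correspondence (Schlickewei2010, Ingalls–Logan–Patashnick; Varesco2025 Thm 0.2) no method applies, and a very general member of a 1-parameter RM family (VanGeemenSchuett2023) may carry a non-algebraic √m-class.
sources: Varesco2025, Schlickewei2010, VanGeemenSchuett2023, Varesco2023, VanGeemen2008RM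
[crux] FIRST OPEN CASE — RMSquares restricted to Picard number 16 (rank T = 6, dim_E T = 3: the
one-parameter RM families of VanGeemenSchuett2023 and the Elsenhans–Jahnel double sextics); known
only for the two 4-dimensional families with algebraic Kuga–Satake correspondence (Varesco2025 Thm
0.2). Designated milestone for the carrier + transport mechanism (explicit anchors and targets in
the same 9-dimensional D_E) and for certified experiments on explicit RM K3 surfaces. [deps:
IsogenyInvariance] [difficulty: open-problem] -/
@[route_item "route-HodgeConjecture-ELineTransport"]
def PicardSixteen : Prop :=
  open Literature.AlgebraicGeometry.Motives Literature.AlgebraicGeometry.HodgeTheory Literature.AlgebraicTopology.SingularHomology in ∀ (S : SchemeOver ℂ), (IsSmoothProjective 2 S ∧ Subsingleton (structureSheafCohomology S.left 1) ∧ ∃ (A : HodgeModel 2 S) (η : Literature.Geometry.Kaehler.MForm 𝓘(ℝ, A.model) A.carrier ℂ 2), Literature.Geometry.Kaehler.IsHolomorphicInCharts η ∧ ∀ x, η x ≠ 0) → Module.finrank ℂ (algebraicClasses S 1) = 16 → ∀ m : ℕ, ¬ IsSquare m → ∀ J : complexBetti S 2 →ₗ[ℂ] complexBetti S 2, ((∀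 c, IsRationalClass c → IsRationalClass (J c)) ∧ (∀ c, J (J c) = (m : ℂ) • c) ∧ (∀ a b, cupProduct rfl (J a) b = cupProduct rfl a (J b)) ∧ (∀ c, IsOfHodgeType 2 S 2 2 0 c → J c = (Real.sqrt m : ℂ) • c)) → (∀ ψ : complexBetti S 2 →ₗ[ℂ] complexBetti S 2, (∀ c, IsRationalClass c → IsRationalClass (ψ c)) → (∀ p q c, IsOfHodgeType 2 S 2 p q c → IsOfHodgeType 2 S 2 p q (ψ c)) → ∃ a b : ℚ, ∀ v, (∀ w ∈ algebraicClasses S 1, cupProduct rfl v w = 0) → ψ v - ((a : ℂ) • v + (b : ℂ) • J v) ∈ algebraicClasses S 1) → (∀ v ∈ Submodule.span ℝ {c : complexBetti S 2 | IsRationalClass c}, J v = -((Real.sqrt m : ℂ) • v) → cupProduct rfl v v = 0 → v = 0) → HodgeConjectureFor 4 (CategoryTheory.MonoidalCategoryStruct.tensorObj S S)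

/-- item stmt-HodgeConjecture-19047 · aside · rank 5 · closed · proved by Summit.HodgeConjecture.HodgeConjecture.Theorems.NikulinTwinTransport.SquareGlueFree.squareHodgeOfEClass_proof @ 366bed484f45 (prover) · by planner
why it might fail: Known bookkeeping (Varesco2023 p.8: HC(X²) ⟺ End_Hdg(T) algebraic; EX pins End_Hdg(T)=ℚ+ℚJ); fails only AS RENDERED: HodgeConjectureFor 4 (S⊗S) ranges over all p and needs a product Hodge model; a mis-normalised complexGysin action is absorbed (γ ranges over a ℂ-subspace).
sources: Varesco2023, Huybrechts2019, VoisinHodgeI2002, Deligne2000, Buskin2019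
[crux, bookkeeping-grade — known mathematics modulo formalisation] KÜNNETH BOOKKEEPING UNDER EX
(piece X₁ of the BC2 redirect of IsogenyInvariance): for every orientation family μ with Poincaré
duality, every projective K3 surface S (K3 clause verbatim), non-square m and E-structure J on
H²(S(ℂ);ℂ) (rational, J∘J = m, cup-self-adjoint, +√m on H^{2,0}) satisfying EX (every rational
type-preserving ψ is a + bJ on NS^⊥ modulo NS), IF the class of J is algebraic — J = [γ]_* :=
fst_*(snd^*(–) ∪ γ) for some γ ∈ algebraicClasses (S ⊗ S) 2 (the rendering of the tree fact
Buskin2019_hodgeIsometry_algebraic, degree 2) — THEN HodgeConjectureFor 4 (S ⊗ S). Proof on paper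
(Varesco2023 p. 8, Huybrechts2019 §1): Hodge classes in H⁴(S×S) are [S×pt], [pt×S], NS ⊗ NS
(products of divisors, Lefschetz (1,1)) and, in T ⊗ T ≅ End(T), End_Hdg(T) = ℚ·id_T + ℚ·J|_T by EX
(Hom_Hdg(T,NS) = 0 since T_ℚ is the smallest Hodge structure containing H^{2,0}); id = [Δ]
algebraic, J algebraic by hypothesis; degrees 2 and 6 by Lefschetz (1,1), pull-back and D × pt; plus
a Hodge model of S ⊗ S (product of analytifications). Formal debt: Künneth for H*((S ⊗ S)(ℂ);ℂ) with
Hodge types (ComplexBettiKunneth, HodgeTypeExter -/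
@[route_item "route-HodgeConjecture-ELineTransport"]
def SquareHodgeOfEClass : Prop :=
  open Literature.AlgebraicGeometry.Motives Literature.AlgebraicGeometry.HodgeTheory Literature.AlgebraicTopology.SingularHomology in ∀ (μ : OrientationFamily), μ.HasPoincareDuality → ∀ (S : SchemeOver ℂ) (hS : (IsSmoothProjective 2 S ∧ Subsingleton (structureSheafCohomology S.left 1) ∧ ∃ (A : HodgeModel 2 S) (η : Literature.Geometry.Kaehler.MForm 𝓘(ℝ, A.model) A.carrier ℂ 2), Literature.Geometry.Kaehler.IsHolomorphicInCharts η ∧ ∀ x, η x ≠ 0)), ∀ m : ℕ, ¬ IsSquare m → ∀ J : complexBetti S 2 →ₗ[ℂ] complexBetti S 2, ((∀ c, IsRationalClass c → IsRationalClass (J c)) ∧ (∀ c, J (J c) = (m : ℂ) • c) ∧ (∀ a b, cupProduct rfl (J a) b = cupProduct rfl a (J b)) ∧ (∀ c, IsOfHodgeType 2 S 2 2 0 c → J c = (Real.sqrt m : ℂ) • c)) → (∀ ψ : complexBetti S 2 →ₗ[ℂ] complexBetti S 2, (∀ c, IsRationalClass c → IsRationalClass (ψ c)) → (∀ p q c,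 IsOfHodgeType 2 S 2 p q c → IsOfHodgeType 2 S 2 p q (ψ c)) → ∃ a b : ℚ, ∀ v, (∀ w ∈ algebraicClasses S 1, cupProduct rfl v w = 0) → ψ v - ((a : ℂ) • v + (b : ℂ) • J v) ∈ algebraicClasses S 1) → (∃ γ ∈ algebraicClasses (CategoryTheory.MonoidalCategoryStruct.tensorObj S S) 2, ∀ x : complexBetti S 2, J x = complexGysin μ (IsSmoothProjective.tensor_holds hS.1 hS.1) hS.1 (CategoryTheory.SemiCartesianMonoidalCategory.fst S S) (rfl : 2 + 2 * 2 + 2 * 2 = 2 + 2 * (2 + 2)) (cupProduct (rfl : 2 + 2 * 2 = 2 + 2 * 2) (complexBetti.map (CategoryTheory.SemiCartesianMonoidalCategory.snd S S) 2 x) γ)) → HodgeConjectureFor 4 (CategoryTheory.MonoidalCategoryStruct.tensorObj S S)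

-- `SquareHodgeOfEClass` holds: proved by `Summit.HodgeConjecture.HodgeConjecture.Theorems.NikulinTwinTransport.SquareGlueFree.squareHodgeOfEClass_proof` @ 366bed484f45 (its module imports this route file, so no `_holds` link can be stated here).

/-- item stmt-HodgeConjecture-19048 · aside · rank 6 · closed · proved by Summit.HodgeConjecture.HodgeConjecture.Theorems.EClassOfSquareHodge.eClassOfSquareHodge_proof @ 25deb06472f1 (prover) · by planner
why it might fail: Known (Künneth components ↔ Hodge morphisms, VoisinHodgeI2002 Lemma 11.41; E-structures are Hodge endomorphisms as h²⁰=1); fails only AS RENDERED, e.g. if [γ]_* through complexGysin with rfl-casts missed some endomorphism of complexBetti S 2 (it cannot: Künneth + Poincaré duality over ℂ).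
sources: VoisinHodgeI2002, Huybrechts2016K3, Zarhin1983HodgeGroupsK3, FultonYoungTableaux1997, Buskin2019
[crux, bookkeeping-grade — known mathematics modulo formalisation] THE E-CLASS OF A SQUARE
SATISFYING HC IS ALGEBRAIC (piece X₂; used at the CM ANCHOR, where EX fails — End_Hdg(T(S₀)) is a
quartic CM field — so it must NOT assume EX): for μ with Poincaré duality, a projective K3 S,
non-square m and an E-structure J (rational, J∘J = m, cup-self-adjoint, +√m on H^{2,0}),
HodgeConjectureFor 4 (S ⊗ S) ⟹ J = [γ]_* for some γ ∈ algebraicClasses (S ⊗ S) 2. Proof on paper: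
(i) an E-structure is a Hodge endomorphism of H²(S,ℚ) (J is real so J = √m on H^{0,2} = conj
H^{2,0}; cup-self-adjointness and (2,0)∪(1,1) ⊂ H^{3,1} = 0 give J H^{1,1} ⟂ H^{2,0} ⊕ H^{0,2}, i.e.
J H^{1,1} ⊆ H^{1,1} by Hodge–Riemann non-degeneracy; h^{2,0} = 1 is the tree's
IsK3Surface.twoZero_line); (ii) Künneth + Poincaré duality: every endomorphism ψ of H²(S) is
[κ(ψ)]_* for a unique class κ(ψ) = Σ pr₁^*ψ(e_i) ∪ pr₂^*e_i^∨ in H² ⊗ H² ⊂ H⁴(S×S) (VoisinHodgeI2002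
Lemma 11.41), rational and of type (2,2) when ψ is rational and Hodge; (iii) HC(S×S) makes κ(J)
algebraic; the orientation scalar of complexGysin is absorbed by rescaling γ. Formal debt: Künneth
surjectivity onto End(H²) on the real carriers (kunneth_span_crossPr -/
@[route_item "route-HodgeConjecture-ELineTransport"]
def EClassOfSquareHodge : Prop :=
  open Literature.AlgebraicGeometry.Motives Literature.AlgebraicGeometry.HodgeTheory Literature.AlgebraicTopology.SingularHomology in ∀ (μ : OrientationFamily), μ.HasPoincareDuality → ∀ (S : SchemeOver ℂ) (hS : (IsSmoothProjective 2 S ∧ Subsingleton (structureSheafCohomology S.left 1) ∧ ∃ (A : HodgeModel 2 S) (η : Literature.Geometry.Kaehler.MForm 𝓘(ℝ, A.model) A.carrier ℂ 2), Literature.Geometry.Kaehler.IsHolomorphicInCharts η ∧ ∀ x, η x ≠ 0)), ∀ m : ℕ, ¬ IsSquare m → ∀ J : complexBetti S 2 →ₗ[ℂ] complexBetti S 2, ((∀ c, IsRationalClass c → IsRationalClass (J c)) ∧ (∀ c, J (J c) = (m : ℂ) • c) ∧ (∀ a b, cupProduct rfl (J a) b = cupProduct rfl a (J b)) ∧ (∀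 c, IsOfHodgeType 2 S 2 2 0 c → J c = (Real.sqrt m : ℂ) • c)) → HodgeConjectureFor 4 (CategoryTheory.MonoidalCategoryStruct.tensorObj S S) → (∃ γ ∈ algebraicClasses (CategoryTheory.MonoidalCategoryStruct.tensorObj S S) 2, ∀ x : complexBetti S 2, J x = complexGysin μ (IsSmoothProjective.tensor_holds hS.1 hS.1) hS.1 (CategoryTheory.SemiCartesianMonoidalCategory.fst S S) (rfl : 2 + 2 * 2 + 2 * 2 = 2 + 2 * (2 + 2)) (cupProduct (rfl : 2 + 2 * 2 = 2 + 2 * 2) (complexBetti.map (CategoryTheory.SemiCartesianMonoidalCategory.snd S S) 2 x) γ))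

-- `EClassOfSquareHodge` holds: proved by `Summit.HodgeConjecture.HodgeConjecture.Theorems.EClassOfSquareHodge.eClassOfSquareHodge_proof` @ 25deb06472f1 (its module imports this route file, so no `_holds` link can be stated here).

/-- item stmt-HodgeConjecture-12552 · support · rank 9 · open · by planner
sources: Huybrechts2016K3, BayerFluckigerVanGeemenSchuett2025, VanGeemen2008RM
[support] ANCHORS EXIST IN EVERY E-ISOMETRY CLASS (known mathematics): for (S₁,J₁) a projective K3
with E-structure and TC there is a projective K3 S₀ of Picard number 18, J₀ with +√m on H^{2,0}(S₀),
and an E-isometry (g, g₄) as in IsogenyInvariance. Sketch: Λ = H²(S₁,ℤ) with J = J₁; TC ⇒ E₊ has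
signature (3,8); take x, y ∈ Λ_ℚ h-orthogonal with ρ-positive squares (density) and T₀ := Ex ⊕ Ey
(signature (2,2), T₀^⊥ of signature (1,17)); σ₀ = isotropic vector of (T₀)_ρ ⊗ ℂ; NS(σ₀)_ℚ = T₀^⊥
exactly (the minimal ℚ-space containing (T₀)_ρ is J-stable, hence T₀); surjectivity of the period
map in projective form (Literature fact Huybrechts_K3_periodSurjective_projective, after a marking
H²(S₁,ℤ) ≅ Λ_K3) gives S₀; J₀ := transport of J; g₄ from the two orientation generators; for a
generic choice, after a Weyl change of marking, E₊ ∩ NS(S₀)_ℝ even contains an ample class (no root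
is orthogonal to E₊ ∩ NS_ℝ since E₋ has no rational points). [difficulty: L] -/
@[route_item "route-HodgeConjecture-ELineTransport", crux]
def CMAnchor : Prop :=
  open Literature.AlgebraicGeometry.Motives Literature.AlgebraicGeometry.HodgeTheory Literature.AlgebraicTopology.SingularHomology in ∀ (S₁ : SchemeOver ℂ), (IsSmoothProjective 2 S₁ ∧ Subsingleton (structureSheafCohomology S₁.left 1) ∧ ∃ (A : HodgeModel 2 S₁) (η : Literature.Geometry.Kaehler.MForm 𝓘(ℝ, A.model) A.carrier ℂ 2), Literature.Geometry.Kaehler.IsHolomorphicInCharts η ∧ ∀ x, η x ≠ 0) → ∀ m : ℕ, ¬ IsSquare m → ∀ (J₁ : complexBetti S₁ 2 →ₗ[ℂ] complexBetti S₁ 2), ((∀ c, IsRationalClass c → IsRationalClass (J₁ c)) ∧ (∀ c, J₁ (J₁ c) = (m : ℂ) • c) ∧ (∀ a b, cupProduct rfl (J₁ a) b = cupProduct rfl a (J₁ b)) ∧ (∀ c, IsOfHodgeType 2 S₁ 2 2 0 c → J₁ c = (Real.sqrt m : ℂ) • c)) → (∀ v ∈ Submodule.span ℝ {c : complexBetti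 S₁ 2 | IsRationalClass c}, J₁ v = -((Real.sqrt m : ℂ) • v) → cupProduct rfl v v = 0 → v = 0) → ∃ (S₀ : SchemeOver ℂ) (J₀ : complexBetti S₀ 2 →ₗ[ℂ] complexBetti S₀ 2), (IsSmoothProjective 2 S₀ ∧ Subsingleton (structureSheafCohomology S₀.left 1) ∧ ∃ (A : HodgeModel 2 S₀) (η : Literature.Geometry.Kaehler.MForm 𝓘(ℝ, A.model) A.carrier ℂ 2), Literature.Geometry.Kaehler.IsHolomorphicInCharts η ∧ ∀ x, η x ≠ 0) ∧ (∀ c, IsOfHodgeType 2 S₀ 2 2 0 c → J₀ c = (Real.sqrt m : ℂ) • c) ∧ Module.finrank ℂ (algebraicClasses S₀ 1) = 18 ∧ ∃ g : complexBetti S₁ 2 ≃ₗ[ℂ] complexBetti S₀ 2, ∃ g₄ : complexBetti S₁ 4 ≃ₗ[ℂ] complexBetti S₀ 4, (∀ c, IsRationalClass c ↔ IsRationalClass (g c)) ∧ (∀ c, g (J₁ c) = J₀ (g c)) ∧ (∀ a b, g₄ (cupProduct rfl a b) = cupProduct rfl (g a) (g b)) ∧ (∀ c, IsIntegralClass c ↔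 IsIntegralClass (g₄ c))

/-- item stmt-HodgeConjecture-12553 · support · rank 9 · open · by planner
sources: Buskin2019, Huybrechts2019, Zarhin1983HodgeGroupsK3, Huybrechts2016K3, Varesco2025
[support] KNOWN — HC(S × S) for projective K3 surfaces S of Picard number ≥ 17: rank T ≤ 5 forces
End_Hdg(T) = ℚ (real multiplication needs dim_E T ≥ 3) or a CM field (Zarhin1983HodgeGroupsK3); case
ℚ: id_T = [Δ] − NS-part − fibres is algebraic; case CM: Buskin2019 Corollary / Huybrechts2019 Cor
0.4(ii) (Literature fact Buskin2019_hodgeConjectureFor_square_of_CM, consumed through IsK3Surface =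
this K3 clause, Iff.rfl); codimensions 0,1,3,4 by Lefschetz (1,1), hard Lefschetz and points.
Supplies HC(S₀×S₀) at the Picard-18 anchors. [difficulty: XL] -/
@[route_item "route-HodgeConjecture-ELineTransport", crux]
def HighPicardSquares : Prop :=
  open Literature.AlgebraicGeometry.Motives Literature.AlgebraicGeometry.HodgeTheory in ∀ (S : SchemeOver ℂ), (IsSmoothProjective 2 S ∧ Subsingleton (structureSheafCohomology S.left 1) ∧ ∃ (A : HodgeModel 2 S) (η : Literature.Geometry.Kaehler.MForm 𝓘(ℝ, A.model) A.carrier ℂ 2), Literature.Geometry.Kaehler.IsHolomorphicInCharts η ∧ ∀ x, η x ≠ 0) → 17 ≤ Module.finrank ℂ (algebraicClasses S 1) → HodgeConjectureFor 4 (CategoryTheory.MonoidalCategoryStruct.tensorObj S S)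

/-- item stmt-HodgeConjecture-12554 · support · rank 9 · closed · proved by Summit.HodgeConjecture.HodgeConjecture.Theorems.eLineTransport_latticeEStructure_proof @ 860810396bd3 (prover) · by planner
sources: BayerFluckigerVanGeemenSchuett2025, BayerFluckigerVanGeemenSchuett2024, VanGeemen2008RM
[support] E-STRUCTURES EXIST ON THE RATIONAL K3 FORM (provable now): for non-square m there is Jm ∈
M₂₂(ℚ) with Jm² = m, self-adjoint for D = diag(1,1,1,−1×19) ≅ II_{3,19} ⊗ ℚ (E₈⊗ℚ ≅ ⟨1⟩⁸), whose
(−√m)-eigenspace is negative definite (so E₊ has signature (3,8)). Witness: over E = ℚ(√m) take H =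
⟨√m,√m,√m,−1/2 ×8⟩; tr⟨√m⟩ ≅ U, tr⟨−1/2⟩ = ⟨−1,−m⟩ and ⟨m⟩⁸ ≅ ⟨1⟩⁸ (m is a sum of four squares,
⟨1,1,1,1⟩ is round), so tr H ≅ D; Jm = multiplication by √m in a rational basis
(BayerFluckigerVanGeemenSchuett2025 Cor 11.4 with r₀ = 3). Grounds D_E and the hypotheses of
ELineConnectivity. [difficulty: provable-now] -/
@[route_item "route-HodgeConjecture-ELineTransport"]
def LatticeEStructure : Prop :=
  ∀ m : ℕ, ¬ IsSquare m → ∃ Jm : Matrix (Fin 22) (Fin 22) ℚ, Jm * Jm = (m : ℚ) • (1 : Matrix (Fin 22) (Fin 22) ℚ) ∧ Jm.transpose * Matrix.diagonal (fun i : Fin 22 => if i.val < 3 then (1 : ℚ) else -1) = Matrix.diagonal (fun i : Fin 22 => if i.val < 3 then (1 : ℚ) else -1) * Jm ∧ ∀ v : Fin 22 → ℝ, v ≠ 0 → (Jm.map (fun x : ℚ => (x : ℝ))).mulVec v = (-(Real.sqrt m)) • v → dotProduct v ((Matrix.diagonal (fun i : Fin 22 => if i.val < 3 then (1 : ℝ)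 else -1)).mulVec v) < 0

-- `LatticeEStructure` holds: proved by `Summit.HodgeConjecture.HodgeConjecture.Theorems.eLineTransport_latticeEStructure_proof` @ 860810396bd3 (its module imports this route file, so no `_holds` link can be stated here).

/-- item stmt-HodgeConjecture-12556 · support · rank 9 · closed · proved by Summit.HodgeConjecture.HodgeConjecture.Theorems.eLineTransport_frameOfSummit_proof @ 679ec515c842 (prover) · by planner
sources: Deligne2000
[support] FRAME (provable now, PROVED in the planner's SketchFrame.lean via
Literature.AlgebraicGeometry.Motives.IsSmoothProjective.tensor_holds): HodgeConjecture → RMSquares —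
X is an instance family of the summit (S ⊗ S is smooth projective of dimension 4), so X cannot be
refuted without refuting HC. [difficulty: provable-now] -/
@[route_item "route-HodgeConjecture-ELineTransport"]
def FrameOfSummit : Prop :=
  _root_.HodgeConjecture → RMSquares

-- `FrameOfSummit` holds: proved by `Summit.HodgeConjecture.HodgeConjecture.Theorems.eLineTransport_frameOfSummit_proof` @ 679ec515c842 (its module imports this route file, so no `_holds` link can be stated here).

/-- item stmt-HodgeConjecture-12557 · support · rank 9 · open · by planner
sources: Deligne2000
[support] SECTOR FRAME (bookkeeping, NOT claimed; D-0027 §2.1 / D-0019 frame 'X → Statement'):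
RMSquares → HodgeConjecture. Implied by the Hodge conjecture itself, hence irrefutable short of ¬HC;
filed only so that the deciding theorem `closes` and the Assembly conclude `_root_.HodgeConjecture`
(the predecessor route-HodgeConjecture-EvenB2Twistor was retired not-a-thesis for stopping at
Target). Its honest content — HC away from squares of exact-RM K3 surfaces with TC — is the open
complement of the sector: refuters skip, provers have nothing to do unless HC is otherwise settled;
graders should judge the route on IsogenyInvariance / CarrierStability / HyperholomorphicTransport /
PicardSixteen. [difficulty: open-problem] -/
@[route_item "route-HodgeConjecture-ELineTransport", crux]
def SectorComplement : Prop :=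
  RMSquares → _root_.HodgeConjecture

/-- item stmt-HodgeConjecture-13981 · support · rank 9 · closed · proved by Summit.HodgeConjecture.HodgeConjecture.Theorems.eLineTransport_eLineConnectivityR_proof @ 053c218f3018 (prover) · by planner
why it might fail: Endpoint degeneracy now excluded (W_i^⊥ ∩ ℚ²² = 0 is necessary; the m=2 witness W₀ ⟂ e₆ violates it). Could still fail only if a generic 3-space carried no generic 2-plane — ruled out on paper: bad planes in Gr(2,W) ≅ ℝP² are countable (one per rational l; End-bad = degree-22 CM-type points).
sources: Huybrechts2016K3, BayerFluckigerVanGeemenSchuett2025, Buskin2019, Zarhin1983HodgeGroupsK3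
[support] REPAIRED ELineConnectivity (stmt-HodgeConjecture-12555 was refuted-misstated by
Theorems.ELineTransportELineConnectivity_refuted: the ENDPOINT 3-planes were not required generic,
so a W₀ D-orthogonal to a rational vector (witness: W₀ = span(e0,e1,e2) ⟂ e₆, m = 2) admits no
generic first link and k = 0 forces W₀ = W₁). GENERIC E-TWISTOR CONNECTIVITY OF D_E BETWEEN GENERIC
ENDPOINT TWISTOR SPACES: for an E-structure Jm on (ℚ²², D = ⟨1³,−1¹⁹⟩) (Jm² = m non-square,
D-self-adjoint, negative definite (−√m)-eigenspace, so E₊ = ker(Jm − √m) has signature (3,8)) and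
two positive definite 3-planes W₀, W₁ ⊂ E₊ that are GENERIC in Huybrechts' sense — W_i^⊥ ∩ ℚ²² = 0,
i.e. no nonzero rational l has q(l,u) = 0 for all u ∈ W_i (Lectures on K3 Surfaces Ch. 7 §3.1: 'T_W
is generic if W^⊥ ∩ Λ = 0 … then x^⊥ ∩ Λ = 0 for all but countably many x ∈ T_W') — there is a
finite chain of positive 3-planes U₀ = W₀, …, U_k = W₁ in E₊ whose consecutive members contain Re x,
Im x of a common period vector x (Jm x = √m x, x·x = 0, x·x̄ > 0) with NS(x) = x^⊥ ∩ ℚ²² = 0 and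
End_Hdg(x) = ℚ + ℚ·Jm (conclusion verbatim as in the refuted item). The new hypothesis is NECESSARY
for k ≥ 1 (a rational l ⟂ W₀ lies -/
@[route_item "route-HodgeConjecture-ELineTransport"]
def ELineConnectivityR : Prop :=
  ∀ m : ℕ, ¬ IsSquare m → ∀ Jm : Matrix (Fin 22) (Fin 22) ℚ, Jm * Jm = (m : ℚ) • (1 : Matrix (Fin 22) (Fin 22) ℚ) → Jm.transpose * Matrix.diagonal (fun i : Fin 22 => if i.val < 3 then (1 : ℚ) else -1) = Matrix.diagonal (fun i : Fin 22 => if i.val < 3 then (1 : ℚ) else -1) * Jm → (∀ v : Fin 22 → ℝ, v ≠ 0 → (Jm.map (fun x : ℚ => (x : ℝ))).mulVec v = (-(Real.sqrt m)) • v → dotProduct v ((Matrix.diagonal (fun i : Fin 22 => if i.val < 3 then (1 : ℝ) else -1)).mulVec v) < 0) → let q : (Fin 22 → ℝ) → (Fin 22 → ℝ) → ℝ := fun v w => dotProduct v ((Matrix.diagonal (fun i : Fin 22 => if i.val < 3 then (1 : ℝ) else -1)).mulVec w); let qc : (Fin 22 → ℂ) → (Fin 22 → ℂ) → ℂ :=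 fun v w => dotProduct v ((Matrix.diagonal (fun i : Fin 22 => if i.val < 3 then (1 : ℂ) else -1)).mulVec w); let Ep : Submodule ℝ (Fin 22 → ℝ) := LinearMap.ker (Matrix.toLin' (Jm.map (fun x : ℚ => (x : ℝ))) - (Real.sqrt m) • LinearMap.id); ∀ (W₀ W₁ : Submodule ℝ (Fin 22 → ℝ)), (W₀ ≤ Ep ∧ Module.finrank ℝ W₀ = 3 ∧ ∀ u ∈ W₀, u ≠ 0 → 0 < q u u) → (W₁ ≤ Ep ∧ Module.finrank ℝ W₁ = 3 ∧ ∀ u ∈ W₁, u ≠ 0 → 0 < q u u) → (∀ l : Fin 22 → ℚ, (∀ u ∈ W₀, q (fun j => ((l j : ℚ) : ℝ)) u = 0) → l = 0) → (∀ l : Fin 22 → ℚ, (∀ u ∈ W₁, q (fun j => ((l j : ℚ) : ℝ)) u = 0) → l = 0) → ∃ (k : ℕ) (U : Fin (k + 1) → Submodule ℝ (Fin 22 → ℝ)), U 0 = W₀ ∧ U (Fin.last k) = W₁ ∧ (∀ i, U i ≤ Ep ∧ Module.finrank ℝ (U i) = 3 ∧ ∀ u ∈ U i, u ≠ 0 →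 0 < q u u) ∧ ∀ i : Fin k, ∃ x : Fin 22 → ℂ, (Jm.map (fun t : ℚ => (t : ℂ))).mulVec x = (Real.sqrt m : ℂ) • x ∧ qc x x = 0 ∧ 0 < (qc (star x) x).re ∧ (fun j => (x j).re) ∈ U i.castSucc ⊓ U i.succ ∧ (fun j => (x j).im) ∈ U i.castSucc ⊓ U i.succ ∧ (∀ l : Fin 22 → ℚ, qc (fun j => (l j : ℂ)) x = 0 → l = 0) ∧ ∀ A : Matrix (Fin 22) (Fin 22) ℚ, (∃ c : ℂ, (A.map (fun t : ℚ => (t : ℂ))).mulVec x = c • x) → (∀ v : Fin 22 → ℂ, qc v x = 0 → qc v (star x) = 0 → qc ((A.map (fun t : ℚ => (t : ℂ))).mulVec v) x = 0 ∧ qc ((A.map (fun t : ℚ => (t : ℂ))).mulVec v) (star x) = 0) → ∃ a b : ℚ, A = a • (1 : Matrix (Fin 22) (Fin 22) ℚ) + b • Jm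

-- `ELineConnectivityR` holds: proved by `Summit.HodgeConjecture.HodgeConjecture.Theorems.eLineTransport_eLineConnectivityR_proof` @ 053c218f3018 (its module imports this route file, so no `_holds` link can be stated here).

/-- item stmt-HodgeConjecture-17599 · support · rank 9 · closed · proved by Summit.HodgeConjecture.HodgeConjecture.Theorems.eLineTransport_isogenyInvarianceOfPieces_proof @ 3dd47600861f (prover) · by planner
[support — GLUE of the BC2-redirect decomposition of the deciding crux IsogenyInvariance
(stmt-HodgeConjecture-12550); PROVED: evidence ELineTransportIsogenyInvarianceSplit.lean on
stmt-12550 (theorem Summit.HodgeConjecture.HodgeConjecture.Theorems.isogenyInvariance_of_pieces,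
lean check rc 0 against the live tree, 0 sorries, axioms propext/Classical.choice/Quot.sound, ≈ 35
tactic lines) — any prover closes this item by landing that file verbatim as
Theorems/ELineTransportIsogenyInvarianceSplit.lean (planners cannot write Theorems)]
SquareHodgeOfEClass → EClassOfSquareHodge → EClassTransport → IsogenyInvariance. Proof: choose an
orientation family μ with Poincaré duality (Motives.ComplexPoints.isOrientableOver +
OrientationFamily.hasPoincareDuality); TRANSPORT the E-structure of (S₁,J₁) to the anchor (S₀,J₀)
through the E-isometry (g,g₄): rationality of J₀ from g rational both ways, J₀∘J₀ = m and
cup-self-adjointness from g J₁ = J₀ g and g₄(a ∪ b) = g a ∪ g b (the crux hands J₀ only with its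
(2,0)-clause); then EClassOfSquareHodge at the anchor (HC(S₀×S₀) ⇒ J₀ = [γ₀]_*), EClassTransport
along (g,g₄) under TC (⇒ J₁ = [γ₁]_*), SquareHodgeOfEClass at the target under EX (⇒ HC(S₁×S₁)). -/
@[route_item "route-HodgeConjecture-ELineTransport"]
def IsogenyInvarianceOfPieces : Prop :=
  SquareHodgeOfEClass → EClassOfSquareHodge → EClassTransport → IsogenyInvariance

-- `IsogenyInvarianceOfPieces` holds: proved by `Summit.HodgeConjecture.HodgeConjecture.Theorems.eLineTransport_isogenyInvarianceOfPieces_proof` @ 3dd47600861f (its module imports this route file, so no `_holds` link can be stated here).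

/-- item stmt-HodgeConjecture-12558 · assembly · rank 1 · closed · proved by Summit.HodgeConjecture.HodgeConjecture.Theorems.eLineTransport_assembly_proof @ c81700764b6c (prover) · by planner
sources: Buskin2019, Deligne2000
[assembly] IsogenyInvariance → CMAnchor → HighPicardSquares → SectorComplement → the sub-problem
statement. -/
@[route_item "route-HodgeConjecture-ELineTransport"]
def Assembly : Prop :=
  IsogenyInvariance → CMAnchor → HighPicardSquares → SectorComplement → _root_.HodgeConjecture

-- `Assembly` holds: proved by `Summit.HodgeConjecture.HodgeConjecture.Theorems.eLineTransport_assembly_proof` @ c81700764b6c (its module imports this route file, so no `_holds` link can be stated here).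

-- records of items no longer active in this route (dropped / restated):
-- earlier ELineConnectivity (stmt-HodgeConjecture-12555, dropped 2026-08-15T20:51:39Z): refuted by Summit.HodgeConjecture.HodgeConjecture.Theorems.ELineTransportELineConnectivity_refuted @ 9a5ff31089d1 — ∀ m : ℕ, ¬ IsSquare m → ∀ Jm : Matrix (Fin 22) (Fin 22) ℚ, Jm * Jm = (m : ℚ) • (1 : Matrix (Fin 22) (Fin 22) ℚ) → Jm.transpose * Matrix.diagonal (fun i : Fin 22 => if i.val < 3 then (1 : ℚ) else -1)

/-! D-0027 §2.1 — DECIDING THEOREM (planner-authored via `route open/edit --closes-file`; by planner-rrefute-HodgeConjecture-ELineTransport-debc45a1-0 2026-08-15T20:51:00Z):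
its hypotheses are this route's items and its conclusion the sub-problem Statement (glue_lint), and it elaborates with this file. -/

@[closes "route-HodgeConjecture-ELineTransport"] theorem closes (hI : IsogenyInvariance) (hA : CMAnchor) (hH : HighPicardSquares)
    (hC : SectorComplement) : _root_.HodgeConjecture := by
  refine hC ?_
  intro S hS m hm J hJ hEX hTC
  obtain ⟨S₀, J₀, hS₀, hJ₀, hrk, hg⟩ := hA S hS m hm J hJ hTC
  exact hI S₀ S hS₀ hS m hm J₀ J hJ₀ hJ hrk hg (hH S₀ hS₀ (by omega)) hEX hTC

end Summit.HodgeConjecture.HodgeConjecture.Theses.ELineTransport
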